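import Mathlib
import HarnessLib
import Summits.NavierStokesRegularity.NavierStokesRegularity.Theorems.TaylorModelRungThreeCertificateSoundField
import Summits.NavierStokesRegularity.NavierStokesRegularity.Theorems.TaylorModelRungThreeCertificateReadoutsLand

/-!
# Crux K1b-DR (stmt-NavierStokesRegularity-23954), line `taylor-model` — certificate SOUNDNESS for the `Readouts`
# block, part 4: transversality, and the assembled theorem `readouts_of_check`

From `checkRO_trans = true`, the coefficient hypothesis `CoefOK φ T` (field bridge of `…CertificateSoundField`,
`Qb_vecR`) and the bilinear bound `bb` of the stage (a `StageNumerics` clause): the TRANSVERSALITY conjunct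
`γ ≤ σf (Qb y y)` of `CertData.Readouts (toCertData φ T)` at the crossing states `y = TP u + w'` of the last sub-step —
`σf (Qb (TP u) (TP u)) = Σ_{q,q'} u^q u^{q'} φ (G_{q,q'})` with `G = trG` exact in `K`, bounded below on `[0,h]` by
`φ (trLow)`, the cross and spread terms by `bb·mT·Sp`, `bb·Sp²` times `Σ|σf|ω`. Then **`readouts_of_check`**:
`Monotone φ → CoefOK φ T → (toCertData φ T).StageNumerics → T.checkReadouts A = true → (toCertData φ T).Readouts`.

MODEL-lattice rung TL-M3 only; nothing here is a statement about the Navier–Stokes equations.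
-/

-- the sub-problem namespace repeats the summit name by design (D-0017)
set_option linter.dupNamespace false

namespace Summit.NavierStokesRegularity.NavierStokesRegularity.Theorems.TaylorModelCert

open scoped BigOperators
open Literature.Analysis.FluidPDE.TaoCascade Literature.Analysis.FluidPDE.TaoCascade.TaylorChain
open Summit.NavierStokesRegularity.NavierStokesRegularity.Theorems.TaylorModelReadout (Qb_add_left Qb_add_right
  Qb_smul_left Qb_smul_right)

namespace CertTables

/-! ### Bilinear sums -/

section Bilinear

variable (d : CertData)

/-- `Qb` of a finite combination in the first slot. [folklore] -/
theorem Qb_sum_smul_left (s : Finset ℕ) (a : ℕ → ℝ) (x : ℕ → (Fin 4 → ℤ → ℝ)) (v : Fin 4 → ℤ → ℝ) :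
    d.Qb (∑ q ∈ s, a q • x q) v = ∑ q ∈ s, a q • d.Qb (x q) v := by
  induction s using Finset.induction_on with
  | empty =>
    simp only [Finset.sum_empty]
    simpa using Qb_smul_left d 0 0 v
  | insert q s hq ih => rw [Finset.sum_insert hq, Finset.sum_insert hq, Qb_add_left, Qb_smul_left, ih]

/-- `Qb` of a finite combination in the second slot. [folklore] -/
theorem Qb_sum_smul_right (s : Finset ℕ) (a : ℕ → ℝ) (x : ℕ → (Fin 4 → ℤ → ℝ)) (u : Fin 4 → ℤ → ℝ) :
    d.Qb u (∑ q ∈ s, a q • x q) = ∑ q ∈ s, a q • d.Qb u (x q) := by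
  induction s using Finset.induction_on with
  | empty =>
    simp only [Finset.sum_empty]
    simpa using Qb_smul_right d 0 u 0
  | insert q s hq ih => rw [Finset.sum_insert hq, Finset.sum_insert hq, Qb_add_right, Qb_smul_right, ih]

end Bilinear

/-! ### TRANSVERSALITY -/

section Trans

variable {K : Type} [Field K] [LinearOrder K] {φ : K →+* ℝ} (hφ : Monotone φ) (T : CertTables K)
include hφ

omit [LinearOrder K] hφ in
/-- The Taylor polynomial as a combination of the jet table vectors. [folklore] -/
theorem TP_eq_sum (j s : ℕ) (u : ℝ) :
    (T.toCertData φ).TP j s u =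
      ∑ q ∈ Finset.range (T.pdeg + 1), u ^ q • T.vecR φ ((T.node j s).P.getD q []) := by
  funext i k
  rw [Finset.sum_apply, Finset.sum_apply]
  show (∑ q ∈ Finset.range (T.pdeg + 1), T.vecR φ ((T.node j s).P.getD q []) i k * u ^ q) = _
  exact Finset.sum_congr rfl fun q _ => by rw [Pi.smul_apply, Pi.smul_apply, smul_eq_mul, mul_comm]

/-- The Taylor polynomial stays in `Ball(mT)` when the row test `tpAbs ≤ mT·ω` passes. [folklore] -/
theorem inBall_TP (j s : ℕ) (h mT : K) (hrow : ∀ c < T.n, T.tpAbs (T.node j s) h c ≤ mT * T.wgt j c)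
    {u : ℝ} (hu : u ∈ Set.Icc 0 (φ h)) : (T.toCertData φ).InBall j ((T.toCertData φ).TP j s u) (φ mT) := by
  rw [T.inBall_iff φ]
  intro c hc
  rw [T.wv_TP φ j s u hc]
  have h1 := hφ (hrow c hc)
  rw [map_mul] at h1
  refine le_trans ?_ h1
  unfold tpAbs
  rw [phi_sumN]
  refine (Finset.abs_sum_le_sum_abs _ _).trans (Finset.sum_le_sum fun q _ => ?_)
  rw [abs_mul, abs_pow, map_mul, phi_abs hφ, map_pow]
  refine mul_le_mul_of_nonneg_left ?_ (abs_nonneg _)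
  exact pow_le_pow_left₀ (abs_nonneg u) (by rw [abs_of_nonneg hu.1]; exact hu.2) _

omit [LinearOrder K] hφ in
/-- The exact value `σf (Qb (TP u) (TP u)) = Σ_{q,q'} u^q u^{q'} φ (trG q q')`. [folklore] -/
theorem sigma_Qb_TP (hco : T.CoefOK φ) (j s : ℕ) (u : ℝ) :
    (T.toCertData φ).σf j ((T.toCertData φ).Qb ((T.toCertData φ).TP j s u) ((T.toCertData φ).TP j s u)) =
      ∑ q ∈ Finset.range (T.pdeg + 1), ∑ q' ∈ Finset.range (T.pdeg + 1),
        u ^ q * u ^ q' * φ (T.trG j (T.node j s) q q') := by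
  rw [T.TP_eq_sum, Qb_sum_smul_left]
  simp only [Qb_sum_smul_right, map_sum, map_smul, smul_eq_mul]
  refine Finset.sum_congr rfl fun q _ => ?_
  rw [Finset.mul_sum]
  refine Finset.sum_congr rfl fun q' _ => ?_
  rw [Qb_vecR hco]
  show u ^ q * (u ^ q' * T.covR φ (T.stage j).σf (T.vecR φ (T.QbVec ((T.node j s).P.getD q []) ((T.node j s).P.getD q' [])))) = _
  rw [T.covR_vecR φ, mul_assoc]
  rfl

/-- The crude lower bound: `φ (trLow) ≤ σf (Qb (TP u) (TP u))` for `u ∈ [0, φ h]`. [folklore] -/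
theorem trLow_le (hco : T.CoefOK φ) (j s : ℕ) (h : K) {u : ℝ} (hu : u ∈ Set.Icc 0 (φ h)) :
    φ (T.trLow j (T.node j s) h) ≤
      (T.toCertData φ).σf j ((T.toCertData φ).Qb ((T.toCertData φ).TP j s u) ((T.toCertData φ).TP j s u)) := by
  rw [T.sigma_Qb_TP hco]
  unfold trLow
  rw [phi_sumN]
  refine Finset.sum_le_sum fun q _ => ?_
  rw [phi_sumN]
  refine Finset.sum_le_sum fun q' _ => ?_
  have hupow : u ^ (q + q') ≤ φ h ^ (q + q') :=
    pow_le_pow_left₀ hu.1 hu.2 _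
  by_cases hqq : q + q' = 0
  · rw [if_pos hqq]
    obtain ⟨rfl, rfl⟩ : q = 0 ∧ q' = 0 := by omega
    simp
  · rw [if_neg hqq, map_neg, map_mul, phi_abs hφ, map_pow]
    have h1 : |u ^ q * u ^ q' * φ (T.trG j (T.node j s) q q')| ≤ |φ (T.trG j (T.node j s) q q')| * φ h ^ (q + q') := by
      rw [abs_mul, abs_mul, abs_of_nonneg (pow_nonneg hu.1 q), abs_of_nonneg (pow_nonneg hu.1 q'), ← pow_add,
        mul_comm]
      exact mul_le_mul_of_nonneg_left hupow (abs_nonneg _)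
    have h2 := neg_abs_le (u ^ q * u ^ q' * φ (T.trG j (T.node j s) q q'))
    linarith

/-- Soundness of `checkRO_trans` (with `CoefOK` and the stage's bilinear bound `bb`): the TRANSVERSALITY conjunct of
`Readouts` at stage `j`. [folklore] -/
theorem ro_trans (hco : T.CoefOK φ) (j : ℕ)
    (hB : ∀ (u v : Fin 4 → ℤ → ℝ) (Nu Nv : ℝ), 0 ≤ Nu → 0 ≤ Nv → (T.toCertData φ).InBall j u Nu →
      (T.toCertData φ).InBall j v Nv → (T.toCertData φ).InBall j ((T.toCertData φ).Qb u v) ((T.toCertData φ).bb j * Nu * Nv))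
    (h : T.checkRO_trans j = true) :
    ∀ u ∈ Set.Icc 0 ((T.toCertData φ).h j ((T.toCertData φ).S j - 1)), ∀ w' : Fin 4 → ℤ → ℝ,
      (T.toCertData φ).InBall j w' ((T.toCertData φ).Sp j ((T.toCertData φ).S j - 1)) →
      (T.toCertData φ).γ j ≤ (T.toCertData φ).σf j ((T.toCertData φ).Qb
        ((T.toCertData φ).TP j ((T.toCertData φ).S j - 1) u + w') ((T.toCertData φ).TP j ((T.toCertData φ).S j - 1) u + w')) := by
  simp only [checkRO_trans, allN_eq_true, Bool.and_eq_true, decide_eq_true_eq] at h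
  obtain ⟨⟨⟨hmT, hSp⟩, hrow⟩, hγ⟩ := h
  change ∀ u ∈ Set.Icc 0 (φ (T.step j ((T.stage j).S - 1)).h), ∀ w' : Fin 4 → ℤ → ℝ,
    (T.toCertData φ).InBall j w' (φ (T.step j ((T.stage j).S - 1)).Sp) →
    φ (T.stage j).γ ≤ (T.toCertData φ).σf j ((T.toCertData φ).Qb
      ((T.toCertData φ).TP j ((T.stage j).S - 1) u + w') ((T.toCertData φ).TP j ((T.stage j).S - 1) u + w'))
  intro u hu w' hw
  set s := (T.stage j).S - 1 with hsdef
  set p := (T.toCertData φ).TP j s u with hp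
  have hmT' := phi_nonneg hφ hmT
  have hSp' := phi_nonneg hφ hSp
  have hpB : (T.toCertData φ).InBall j p (φ (T.step j s).mT) := T.inBall_TP hφ j s _ _ hrow hu
  -- split Qb (p + w') (p + w') into four pieces
  have hsplit : (T.toCertData φ).Qb (p + w') (p + w') =
      (T.toCertData φ).Qb p p + (T.toCertData φ).Qb p w' + ((T.toCertData φ).Qb w' p + (T.toCertData φ).Qb w' w') := by
    rw [Qb_add_left, Qb_add_right, Qb_add_right]
  rw [hsplit, map_add, map_add, map_add]
  have h0 := T.trLow_le hφ hco j s _ hu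
  have h1 := T.abs_sigma_le hφ j _ _ (hB p w' _ _ hmT' hSp' hpB hw)
  have h2 := T.abs_sigma_le hφ j _ _ (hB w' p _ _ hSp' hmT' hw hpB)
  have h3 := T.abs_sigma_le hφ j _ _ (hB w' w' _ _ hSp' hSp' hw hw)
  rw [abs_le] at h1 h2 h3
  have hγ' := hφ hγ
  simp only [map_sub, map_mul, map_add, map_pow, map_ofNat] at hγ'
  have e : (T.toCertData φ).bb j = φ (T.stage j).bb := rfl
  rw [e] at h1 h2 h3
  nlinarith [h1.1, h2.1, h3.1, h0, hγ', phi_nonneg hφ (le_refl (0:K))]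

end Trans

/-! ### The assembled theorem -/

section Assembly

variable {K : Type} [Field K] [LinearOrder K] {φ : K →+* ℝ} (hφ : Monotone φ) (T : CertTables K)
  (A : ReadoutAux K)
include hφ

/-- **Soundness of the `Readouts` checker.** For a monotone ring map `φ : K →+* ℝ`, under the coefficient
hypothesis `CoefOK φ T` of the field bridge and given the `StageNumerics` block of the interpreted record (its bilinear
bound `bb` is used by transversality), `checkReadouts = true` implies the `Readouts` block of
`CertData.Valid (toCertData φ T)`. [folklore] -/
theorem readouts_of_check (hco : T.CoefOK φ) (hSN : (T.toCertData φ).StageNumerics)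
    (h : T.checkReadouts A = true) : (T.toCertData φ).Readouts := by
  simp only [checkReadouts, allN_eq_true, Bool.and_eq_true] at h
  obtain ⟨haux, hst⟩ := h
  intro j hj
  have hj' : j < T.N₀ + 1 := Nat.lt_succ_of_le hj
  have hstage := hst j hj'
  simp only [checkReadoutsStage, checkRO_noTrans, Bool.and_eq_true] at hstage
  obtain ⟨⟨⟨⟨⟨hprod, hsc⟩, hsec⟩, hcr⟩, hland⟩, htr⟩ := hstage
  have hB := (hSN.2 j hj).2
  exact ⟨T.ro_products hφ j hprod, T.ro_gamma hφ j hsc, T.ro_sigma hφ j hsc, (T.ro_section hφ j hsec).1,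
    (T.ro_section hφ j hsec).2, T.ro_trans hφ hco j hB htr, T.ro_crossing hφ A haux j hcr hsc,
    T.ro_land hφ A haux j hland, T.ro_lambdaX hφ j hsc, T.ro_ndl hφ j hsc, T.ro_L1guard hφ j hsc⟩

end Assembly

end CertTables

end Summit.NavierStokesRegularity.NavierStokesRegularity.Theorems.TaylorModelCert
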